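import Mathlib.Analysis.Complex.OpenMapping
import Literature.Analysis.Complex.KoebeCovering
import Literature.Probability.RandomPlanarGeometry.ConformalRemovability
import HarnessLib

/-!
# Conformal removability: the Riemann map of a Hölder domain along radii

Support for the proof of `JonesSmirnov2000_frontier_of_isHolderDomain` (Jones–Smirnov 2000,
Cor. 2; `ConformalRemovability.lean`). For a Hölder domain `Ω = φ(𝔻)` (`IsHolderDomain`: `φ` a
conformal equivalence `𝔻 → Ω`, Hölder continuous on `𝔻`), the two geometric estimates of the
proof — the quasihyperbolic boundary condition behind `Σ_Q q(Q)² l(Q)² < ∞` (Jones–Smirnov, proof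
of Cor. 2, p. 267, and Thm. 3 ⇒ Thm. 2) and the mean porosity of `∂Ω` (Koskela–Rohde 1997, §5) —
are read off the RADII `r ↦ φ(rζ)`, `|ζ| = 1`. This file provides the common inputs:

* `isOpen_of_conformalEquiv_ball`, `isBounded_of_holderOnWith`, `exists_not_mem_of_holderOnWith`
  — `Ω` is open (open mapping theorem) and bounded, `Ωᶜ ≠ ∅`;
* `ball_subset_of_conformalEquiv_ball` — **Koebe at an interior point**:
  `B(φ(w), (1-|w|)|φ'(w)|/(128π)) ⊆ Ω`, from the tree's Koebe covering theorem with explicit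
  constant (`Complex.ball_subset_image_of_injOn`, `KoebeCovering.lean`; the sharp `1/4` is not
  needed); hence `le_infDist_of_conformalEquiv_ball`:
  `(1-|w|)|φ'(w)| ≤ 128π · dist(φ(w), ∂Ω)` — the density bound making the quasihyperbolic length
  of `φ([0, r]ζ)` at most `128π log(1/(1-r))`;
* `exists_radialLimit` — **radial limits**: for `|ζ| = 1` the limit `ξ(ζ) = lim_{r→1} φ(rζ)`
  exists, lies on `∂Ω`, and `|φ(rζ) - ξ(ζ)| ≤ C (1-r)^α`;
* `exists_radial_of_mem_frontier` — **every boundary point is a radial limit** with the same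
  bound (compactness of the closed disc and Hölder continuity).

## References

* [JonesSmirnov2000] P. W. Jones, S. K. Smirnov, Ark. Mat. 38 (2000) 263–279, p. 266–267.
* J. Becker, Ch. Pommerenke, *Hölder continuity of conformal mappings and non-quasiconformal
  Jordan curves*, Comment. Math. Helv. 57 (1982) 221–225 (Hölder domains via the quasihyperbolic
  metric); Ch. Pommerenke, *Boundary Behaviour of Conformal Maps* (1992), §4.6 (8).
-/

noncomputable section

open Set Filter Metric Complex
open scoped Topology NNReal

namespace Literature.Probability.RandomPlanarGeometry

variable {Ω : Set ℂ}

/-! ### Openness, boundedness -/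

/-- The target of a conformal equivalence of the unit disc is open (open mapping theorem; the
map is injective, hence not constant). [folklore] -/
theorem isOpen_of_conformalEquiv_ball (φ : ConformalEquiv (ball (0 : ℂ) 1) Ω) : IsOpen Ω := by
  have han : AnalyticOnNhd ℂ φ (ball 0 1) := φ.differentiableOn_coe.analyticOnNhd isOpen_ball
  rcases han.is_constant_or_isOpen (convex_ball 0 1).isPreconnected with ⟨w, hw⟩ | hopen
  · exfalso
    have h0 : (0 : ℂ) ∈ ball (0 : ℂ) 1 := mem_ball_self one_pos
    have h12 : ((1 : ℂ) / 2) ∈ ball (0 : ℂ) 1 := by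
      rw [mem_ball_zero_iff, norm_div, norm_one, Complex.norm_ofNat]
      norm_num
    have := φ.injOn h0 h12 ((hw 0 h0).trans (hw _ h12).symm)
    norm_num at this
  · have := hopen (ball 0 1) Subset.rfl isOpen_ball
    rwa [φ.bijOn.image_eq] at this

/-- The target of a Hölder continuous conformal equivalence of the unit disc lies in the closed
disc of radius `C` about `φ(0)`. [folklore] -/
theorem subset_closedBall_of_holderOnWith (φ : ConformalEquiv (ball (0 : ℂ) 1) Ω) {C α : ℝ≥0}
    (hH : HolderOnWith C α φ (ball (0 : ℂ) 1)) : Ω ⊆ closedBall (φ 0) C := by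
  rintro z hz
  obtain ⟨u, hu, rfl⟩ := φ.bijOn.surjOn hz
  rw [mem_closedBall]
  have h := hH.dist_le_of_le hu (mem_ball_self one_pos) (d := 1) (by simpa using (mem_ball_zero_iff.1 hu).le)
  simpa using h

/-- The target of a Hölder continuous conformal equivalence of the unit disc is bounded.
[folklore] -/
theorem isBounded_of_holderOnWith (φ : ConformalEquiv (ball (0 : ℂ) 1) Ω) {C α : ℝ≥0}
    (hH : HolderOnWith C α φ (ball (0 : ℂ) 1)) : Bornology.IsBounded Ω :=
  isBounded_closedBall.subset (subset_closedBall_of_holderOnWith φ hH)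

/-- The complement of the target is non-empty. [folklore] -/
theorem compl_nonempty_of_holderOnWith (φ : ConformalEquiv (ball (0 : ℂ) 1) Ω) {C α : ℝ≥0}
    (hH : HolderOnWith C α φ (ball (0 : ℂ) 1)) : Ωᶜ.Nonempty := by
  refine ⟨φ 0 + ((C : ℝ) + 1 : ℝ), fun h => ?_⟩
  have := subset_closedBall_of_holderOnWith φ hH h
  rw [mem_closedBall, dist_eq_norm, add_sub_cancel_left, Complex.norm_real, Real.norm_eq_abs,
    abs_of_nonneg (by positivity)] at this
  linarith

/-! ### Koebe at an interior point -/

/-- **Koebe's covering theorem at an interior point** (constant `1/(128π)` from the tree's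
`Complex.ball_subset_image_of_injOn`): for `φ` a conformal equivalence of `𝔻` onto `Ω` and
`|w| < 1`, `B(φ(w), (1 - |w|) |φ'(w)| / (128π)) ⊆ Ω` (apply the covering theorem to
`u ↦ φ(w + (1-|w|)u)`). [folklore] -/
theorem ball_subset_of_conformalEquiv_ball (φ : ConformalEquiv (ball (0 : ℂ) 1) Ω) {w : ℂ}
    (hw : w ∈ ball (0 : ℂ) 1) :
    ball (φ w) ((1 - ‖w‖) * ‖deriv φ w‖ / (128 * Real.pi)) ⊆ Ω := by
  set ρ : ℝ := 1 - ‖w‖ with hρ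
  have hρ0 : 0 < ρ := by rw [mem_ball_zero_iff] at hw; linarith
  set g : ℂ → ℂ := fun u => φ (w + ρ * u) with hg
  have hmaps : MapsTo (fun u : ℂ => w + ρ * u) (ball 0 1) (ball 0 1) := by
    intro u hu
    rw [mem_ball_zero_iff] at hu ⊢
    calc ‖w + ρ * u‖ ≤ ‖w‖ + ‖(ρ : ℂ) * u‖ := norm_add_le _ _
      _ = ‖w‖ + ρ * ‖u‖ := by rw [norm_mul, Complex.norm_real, Real.norm_of_nonneg hρ0.le]
      _ < ‖w‖ + ρ * 1 := by gcongr
      _ = 1 := by rw [hρ]; ring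
  have hgd : DifferentiableOn ℂ g (ball 0 1) :=
    φ.differentiableOn_coe.comp (by fun_prop) hmaps
  have hginj : InjOn g (ball 0 1) := by
    intro u hu v hv h
    have h1 := φ.injOn (hmaps hu) (hmaps hv) h
    have hρne : (ρ : ℂ) ≠ 0 := by exact_mod_cast hρ0.ne'
    simpa [hρne] using h1
  have hK := Complex.ball_subset_image_of_injOn hgd hginj
  have hg0 : g 0 = φ w := by simp [hg]
  have hdg : deriv g 0 = ρ * deriv φ w := by
    have hφ : HasDerivAt φ (deriv φ w) (w + ρ * 0) := by
      rw [mul_zero, add_zero]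
      exact (φ.differentiableOn_coe.differentiableAt (isOpen_ball.mem_nhds hw)).hasDerivAt
    have hlin : HasDerivAt (fun u : ℂ => w + ρ * u) ρ 0 := by
      simpa using ((hasDerivAt_id (0 : ℂ)).const_mul (ρ : ℂ)).const_add w
    have := (hφ.comp 0 hlin).deriv
    rw [show (φ ∘ fun u : ℂ => w + ρ * u) = g from rfl] at this
    rw [this]
    ring
  rw [hg0, hdg, norm_mul, Complex.norm_real, Real.norm_of_nonneg hρ0.le] at hK
  calc ball (φ w) (ρ * ‖deriv φ w‖ / (128 * Real.pi)) ⊆ g '' ball 0 1 := hK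
    _ ⊆ Ω := by
        rintro _ ⟨u, hu, rfl⟩
        exact φ.mapsTo (hmaps hu)

/-- **Distance to the boundary from below**: `(1 - |w|) |φ'(w)| / (128π) ≤ dist(φ(w), Ωᶜ)`.
[folklore] -/
theorem le_infDist_of_conformalEquiv_ball (φ : ConformalEquiv (ball (0 : ℂ) 1) Ω) {w : ℂ}
    (hw : w ∈ ball (0 : ℂ) 1) (hΩ : Ωᶜ.Nonempty) :
    (1 - ‖w‖) * ‖deriv φ w‖ / (128 * Real.pi) ≤ infDist (φ w) Ωᶜ := by
  refine (le_infDist hΩ).2 fun y hy => ?_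
  by_contra h
  refine hy (ball_subset_of_conformalEquiv_ball φ hw ?_)
  rw [mem_ball, dist_comm]
  exact not_le.1 h

/-! ### Radial limits -/

/-- Points `rζ` of a radius lie in the disc. [folklore] -/
theorem ofReal_mul_mem_ball {ζ : ℂ} (hζ : ‖ζ‖ = 1) {r : ℝ} (hr0 : 0 ≤ r) (hr1 : r < 1) :
    (r : ℂ) * ζ ∈ ball (0 : ℂ) 1 := by
  rw [mem_ball_zero_iff, norm_mul, Complex.norm_real, Real.norm_of_nonneg hr0, hζ, mul_one]
  exact hr1

/-- Hölder continuity along a radius: `|φ(rζ) - φ(sζ)| ≤ C |r - s|^α`. [folklore] -/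
theorem dist_radial_le {φ : ℂ → ℂ} {C α : ℝ≥0} (hH : HolderOnWith C α φ (ball (0 : ℂ) 1))
    {ζ : ℂ} (hζ : ‖ζ‖ = 1) {r s : ℝ} (hr0 : 0 ≤ r) (hr1 : r < 1) (hs0 : 0 ≤ s) (hs1 : s < 1) :
    dist (φ (r * ζ)) (φ (s * ζ)) ≤ C * |r - s| ^ (α : ℝ) := by
  refine hH.dist_le_of_le (ofReal_mul_mem_ball hζ hr0 hr1) (ofReal_mul_mem_ball hζ hs0 hs1) ?_
  rw [dist_eq_norm, ← sub_mul, norm_mul, hζ, mul_one, ← Complex.ofReal_sub, Complex.norm_real,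
    Real.norm_eq_abs]

/-- **Radial limits of the Riemann map of a Hölder domain.** For `|ζ| = 1` there is a point
`ξ ∈ ∂Ω` with `|φ(rζ) - ξ| ≤ C (1 - r)^α` for all `0 ≤ r < 1` (the radius is a Cauchy path by
Hölder continuity; its limit is not in `Ω` because `φ⁻¹` is continuous on the open set `Ω` and
`rζ → ζ ∉ 𝔻`). [folklore] -/
theorem exists_radialLimit (φ : ConformalEquiv (ball (0 : ℂ) 1) Ω) {C α : ℝ≥0} (hα : 0 < α)
    (hH : HolderOnWith C α φ (ball (0 : ℂ) 1)) {ζ : ℂ} (hζ : ‖ζ‖ = 1) :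
    ∃ ξ : ℂ, ξ ∈ frontier Ω ∧ ∀ r : ℝ, 0 ≤ r → r < 1 → dist (φ (r * ζ)) ξ ≤ C * (1 - r) ^ (α : ℝ) := by
  -- the sequence `φ(r_n ζ)`, `r_n = 1 - 1/(n+1)`
  set rs : ℕ → ℝ := fun n => 1 - 1 / ((n : ℝ) + 1) with hrs
  have hrs0 : ∀ n, 0 ≤ rs n := fun n => by
    simp only [hrs]
    rw [sub_nonneg, div_le_one (by positivity)]
    linarith [n.cast_nonneg (α := ℝ)]
  have hrs1 : ∀ n, rs n < 1 := fun n => by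
    simp only [hrs]
    linarith [show (0 : ℝ) < 1 / ((n : ℝ) + 1) by positivity]
  have hrs_lim : Tendsto rs atTop (𝓝 1) := by
    have : Tendsto (fun n : ℕ => 1 / ((n : ℝ) + 1)) atTop (𝓝 0) := tendsto_one_div_add_atTop_nhds_zero_nat
    simpa [hrs] using (tendsto_const_nhds (x := (1 : ℝ))).sub this
  set u : ℕ → ℂ := fun n => φ (rs n * ζ) with hu
  -- it is Cauchy
  have hαr : (0 : ℝ) < α := by exact_mod_cast hα
  have hCauchy : CauchySeq u := by
    refine cauchySeq_of_le_tendsto_0 (fun N => (C : ℝ) * (1 / ((N : ℝ) + 1)) ^ (α : ℝ)) (fun n m N hn hm => ?_) ?_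
    · calc dist (u n) (u m) ≤ C * |rs n - rs m| ^ (α : ℝ) := dist_radial_le hH hζ (hrs0 n) (hrs1 n) (hrs0 m) (hrs1 m)
        _ ≤ C * (1 / ((N : ℝ) + 1)) ^ (α : ℝ) := by
            gcongr
            simp only [hrs]
            rw [show (1 : ℝ) - 1 / (n + 1) - (1 - 1 / (m + 1)) = 1 / (m + 1) - 1 / (n + 1) by ring, abs_le]
            have hnN : (1 : ℝ) / (n + 1) ≤ 1 / (N + 1) :=
              one_div_le_one_div_of_le (by positivity) (by exact_mod_cast Nat.add_le_add_right hn 1)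
            have hmN : (1 : ℝ) / (m + 1) ≤ 1 / (N + 1) :=
              one_div_le_one_div_of_le (by positivity) (by exact_mod_cast Nat.add_le_add_right hm 1)
            constructor <;> nlinarith [show (0:ℝ) ≤ 1 / (n+1) by positivity, show (0:ℝ) ≤ 1/(m+1) by positivity]
    · have h1 : Tendsto (fun N : ℕ => (1 : ℝ) / ((N : ℝ) + 1)) atTop (𝓝 0) := tendsto_one_div_add_atTop_nhds_zero_nat
      have h2 := h1.rpow_const (p := (α : ℝ)) (Or.inr hαr.le)
      rw [Real.zero_rpow hαr.ne'] at h2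
      simpa using h2.const_mul (C : ℝ)
  obtain ⟨ξ, hξ⟩ := cauchySeq_tendsto_of_complete hCauchy
  -- the bound `dist (φ (r ζ)) ξ ≤ C (1 - r)^α`
  have hbound : ∀ r : ℝ, 0 ≤ r → r < 1 → dist (φ (r * ζ)) ξ ≤ C * (1 - r) ^ (α : ℝ) := by
    intro r hr0 hr1
    have hlim : Tendsto (fun n => dist (φ (r * ζ)) (u n)) atTop (𝓝 (dist (φ (r * ζ)) ξ)) :=
      tendsto_const_nhds.dist hξ
    refine le_of_tendsto hlim ?_
    -- eventually `rs n ≥ r`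
    have hev : ∀ᶠ n in atTop, r < rs n := hrs_lim.eventually (lt_mem_nhds hr1)
    filter_upwards [hev] with n hn
    calc dist (φ (r * ζ)) (u n) ≤ C * |r - rs n| ^ (α : ℝ) := dist_radial_le hH hζ hr0 hr1 (hrs0 n) (hrs1 n)
      _ ≤ C * (1 - r) ^ (α : ℝ) := by
          gcongr
          rw [abs_sub_comm, abs_of_pos (by linarith)]
          linarith [hrs1 n]
  refine ⟨ξ, ⟨?_, ?_⟩, hbound⟩
  · -- `ξ ∈ closure Ω`
    exact mem_closure_of_tendsto hξ (Eventually.of_forall fun n => φ.mapsTo (ofReal_mul_mem_ball hζ (hrs0 n) (hrs1 n)))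
  · -- `ξ ∉ interior Ω = Ω`
    rw [(isOpen_of_conformalEquiv_ball φ).interior_eq]
    intro hξΩ
    have hΩo := isOpen_of_conformalEquiv_ball φ
    -- `φ.symm (u n) = rs n * ζ → φ.symm ξ ∈ 𝔻`, but also `→ ζ`
    have h1 : Tendsto (fun n => φ.symm (u n)) atTop (𝓝 (φ.symm ξ)) :=
      ((φ.symm.continuousOn.continuousAt (hΩo.mem_nhds hξΩ)).tendsto).comp hξ
    have h2 : (fun n => φ.symm (u n)) = fun n => ((rs n : ℝ) : ℂ) * ζ :=
      funext fun n => φ.symm_apply_apply (ofReal_mul_mem_ball hζ (hrs0 n) (hrs1 n))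
    have h3 : Tendsto (fun n => ((rs n : ℝ) : ℂ) * ζ) atTop (𝓝 ζ) := by
      have := ((Complex.continuous_ofReal.tendsto 1).comp hrs_lim).mul_const ζ
      simpa using this
    rw [h2] at h1
    have heq : φ.symm ξ = ζ := tendsto_nhds_unique h1 h3
    have hmem : φ.symm ξ ∈ ball (0 : ℂ) 1 := φ.symm_mapsTo hξΩ
    rw [heq, mem_ball_zero_iff, hζ] at hmem
    exact lt_irrefl _ hmem

/-- **Every boundary point of a Hölder domain is a radial limit**: for `ξ ∈ ∂Ω` there is
`|ζ| = 1` with `|φ(rζ) - ξ| ≤ C (1 - r)^α` for all `0 ≤ r < 1`. Proof: `ξ = lim φ(u_n)`,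
`u_n ∈ 𝔻`; a subsequence of `u_n` converges to some `ζ` of the CLOSED disc, necessarily with
`|ζ| = 1` (otherwise `ξ = φ(ζ) ∈ Ω`), and Hölder continuity transfers the radius at `ζ` to the
points `u_n`. [folklore] -/
theorem exists_radial_of_mem_frontier (φ : ConformalEquiv (ball (0 : ℂ) 1) Ω) {C α : ℝ≥0}
    (hα : 0 < α) (hH : HolderOnWith C α φ (ball (0 : ℂ) 1)) {ξ : ℂ} (hξ : ξ ∈ frontier Ω) :
    ∃ ζ : ℂ, ‖ζ‖ = 1 ∧ ∀ r : ℝ, 0 ≤ r → r < 1 → dist (φ (r * ζ)) ξ ≤ C * (1 - r) ^ (α : ℝ) := by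
  have hΩo := isOpen_of_conformalEquiv_ball φ
  have hαr : (0 : ℝ) < α := by exact_mod_cast hα
  rw [frontier, hΩo.interior_eq] at hξ
  obtain ⟨hξc, hξΩ⟩ := hξ
  obtain ⟨z, hzΩ, hzξ⟩ := mem_closure_iff_seq_limit.1 hξc
  set u : ℕ → ℂ := fun n => φ.symm (z n) with hu
  have huball : ∀ n, u n ∈ ball (0 : ℂ) 1 := fun n => φ.symm_mapsTo (hzΩ n)
  have hφu : ∀ n, φ (u n) = z n := fun n => φ.apply_symm_apply (hzΩ n)
  -- a convergent subsequence in the closed disc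
  obtain ⟨ζ, hζmem, ψ, hψ, hlim⟩ := (isCompact_closedBall (0 : ℂ) 1).tendsto_subseq
    fun n => ball_subset_closedBall (huball n)
  -- `|ζ| = 1`
  have hζ1 : ‖ζ‖ = 1 := by
    have hle : ‖ζ‖ ≤ 1 := mem_closedBall_zero_iff.1 hζmem
    rcases hle.lt_or_eq with hlt | heq
    · exfalso
      have hζball : ζ ∈ ball (0 : ℂ) 1 := mem_ball_zero_iff.2 hlt
      have h1 : Tendsto (fun n => φ (u (ψ n))) atTop (𝓝 (φ ζ)) :=
        ((φ.continuousOn.continuousAt (isOpen_ball.mem_nhds hζball)).tendsto).comp hlim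
      have h2 : Tendsto (fun n => φ (u (ψ n))) atTop (𝓝 ξ) := by
        simp only [hφu]
        exact hzξ.comp hψ.tendsto_atTop
      have := tendsto_nhds_unique h1 h2
      exact hξΩ (this ▸ φ.mapsTo hζball)
    · exact heq
  refine ⟨ζ, hζ1, fun r hr0 hr1 => ?_⟩
  -- transfer the radius at `ζ` to the points `u (ψ n)`: the three-term bound tends to `C (1-r)^α`
  have hRHS : Tendsto (fun n => (C : ℝ) * (r * ‖ζ - u (ψ n)‖) ^ (α : ℝ) + C * (1 - r) ^ (α : ℝ) +
      dist (z (ψ n)) ξ) atTop (𝓝 (C * (1 - r) ^ (α : ℝ))) := by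
    have h1 : Tendsto (fun n => r * ‖ζ - u (ψ n)‖) atTop (𝓝 0) := by
      have : Tendsto (fun n => ζ - u (ψ n)) atTop (𝓝 0) := by
        simpa using (tendsto_const_nhds (x := ζ)).sub hlim
      simpa using (tendsto_norm_zero.comp this).const_mul r
    have h2 := (h1.rpow_const (p := (α : ℝ)) (Or.inr hαr.le)).const_mul (C : ℝ)
    rw [Real.zero_rpow hαr.ne', mul_zero] at h2
    have h3 : Tendsto (fun n => dist (z (ψ n)) ξ) atTop (𝓝 0) := by
      have := (tendsto_iff_dist_tendsto_zero.1 hzξ).comp hψ.tendsto_atTop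
      exact this
    simpa using (h2.add_const (C * (1 - r) ^ (α : ℝ))).add h3
  refine le_of_tendsto_of_tendsto' tendsto_const_nhds hRHS fun n => ?_
  have hun := huball (ψ n)
  have hun1 : ‖u (ψ n)‖ < 1 := mem_ball_zero_iff.1 hun
  have hrun : (r : ℂ) * u (ψ n) ∈ ball (0 : ℂ) 1 := by
    rw [mem_ball_zero_iff, norm_mul, Complex.norm_real, Real.norm_of_nonneg hr0]
    exact mul_lt_one_of_nonneg_of_lt_one_left hr0 hr1 hun1.le
  have hrζ := ofReal_mul_mem_ball hζ1 hr0 hr1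
  have t1 : dist (φ (r * ζ)) (φ (r * u (ψ n))) ≤ C * (r * ‖ζ - u (ψ n)‖) ^ (α : ℝ) := by
    refine hH.dist_le_of_le hrζ hrun ?_
    rw [dist_eq_norm, ← mul_sub, norm_mul, Complex.norm_real, Real.norm_of_nonneg hr0]
  have t2 : dist (φ (r * u (ψ n))) (φ (u (ψ n))) ≤ C * (1 - r) ^ (α : ℝ) := by
    refine hH.dist_le_of_le hrun hun ?_
    rw [dist_eq_norm, show (r : ℂ) * u (ψ n) - u (ψ n) = ((r - 1 : ℝ) : ℂ) * u (ψ n) by push_cast; ring,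
      norm_mul, Complex.norm_real, Real.norm_eq_abs, abs_sub_comm, abs_of_nonneg (by linarith)]
    nlinarith [norm_nonneg (u (ψ n))]
  have t3 : dist (φ (u (ψ n))) ξ = dist (z (ψ n)) ξ := by rw [hφu]
  calc dist (φ (r * ζ)) ξ ≤ dist (φ (r * ζ)) (φ (r * u (ψ n))) +
        dist (φ (r * u (ψ n))) (φ (u (ψ n))) + dist (φ (u (ψ n))) ξ := dist_triangle4 _ _ _ _
    _ ≤ _ := by rw [t3]; linarith

end Literature.Probability.RandomPlanarGeometry
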